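import Summits.CriticalPhenomena.SAWScalingLimit.Theorems.SAWDefectDecoherenceBoundaryClosureRPickEngineStarRegrouping
import Summits.CriticalPhenomena.SAWScalingLimit.Theorems.SAWDefectDecoherenceDecoherenceSynthesis
import Literature.Analysis.Complex.WeylLemmaDbar

/-!
# Pick engine, STAGE 1 (S2): the summed lattice identity and its `O(δ · mass)` bound

Support file for crux `BoundaryClosureR` (stmt-CriticalPhenomena-14004), line `pick-half-plane`,
stub `stub_pickEngine`, step (S2).  For a finite vertex set `S`, a function `F` on mid-edges
satisfying the vertex relations on `S`, a test function `φ` supported in a compact `K`, a mesh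
`0 < δ ≤ ε₀` such that every face whose scaled centre lies in the `ε₀`-thickening of `K` belongs
to `S` (the exhaustion clause of the target frame at scale `δ`), and a per-edge Taylor bound with
constant `C` (the conclusion of `pickEngine_edgeTaylor`), one has the EVENTUAL LATTICE INEQUALITY

  `‖(1/3)·δ²(Σᶠ_{z ∈ Ω_S} ∂̄φ(δ·mid z) F z)/F(b) + 3a³·δ²(Σᶠ_{p up-oriented} ∂φ(δ·mid) conj(c₂-c₁) F)/F(b)‖`
     `≤ 2C · δ · δ²(Σᶠ_{z ∈ Ω_S, δ·mid z ∈ K_{ε₀}} ‖F z‖)/‖F(b)‖`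

(`pickEngine_weakDbarBound`): the first term is `(1/3)·N_δ(∂̄φ)`, the second is `3a³` times the
conjugate-class sum of the route's `ConjugateClassNegligible` with test function `∂φ`, and the
right side is `2Cδ` times the local `L¹` mass of `LocalL1Bound`.  Ingredients: the weighted star
regrouping (`starRegrouping_of_satisfiesVertexRelations`) with weights `φ(δc_v)` — boundary darts
do not contribute since a face of `S` with a neighbour off `S` has its scaled centre off `K` —,
the per-edge identity summed over the up-oriented interior edges, and three conversions between
the up-oriented interior sums and the `finsum`s of the route/skeleton (`finsum_pairs_eq_sum_up`,
`finsum_midEdges_eq_sum_up`, `sum_up_norm_le_finsum`).  No limit is taken here.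
References: Duminil-Copin–Smirnov (2012), §3.
-/

noncomputable section

open scoped BigOperators ComplexConjugate
open Finset Set Metric Complex
open Literature.Probability.LatticeModels Literature.Probability.RandomPlanarGeometry
open Literature.Probability.RandomPlanarGeometry.SAW
open Literature.Barriers.CriticalPhenomena Literature.Barriers.CriticalPhenomena.HexGreen
open Literature.Barriers.CriticalPhenomena.HexKernel (vecA term)
open Literature.Analysis.Complex (dbarAlong dbarAlong_eq_zero_of_notMem_tsupport)
open Summit.CriticalPhenomena.SAWScalingLimit.Cruxes.DefectDecoherence.TipMartingaleDepthInduction.WallExitTwoPoint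
  (dist_hexCenter_le_one_of_adj)
open Summit.CriticalPhenomena.SAWScalingLimit.Theorems.DecoherenceSynthesis (dist_smul_smul
  norm_hexMidpoint_sub_hexCenter_le)
open Summit.CriticalPhenomena.SAWScalingLimit.Theorems.MassRatio.Negative (hexDomainMidEdges_finite)

namespace Summit.CriticalPhenomena.SAWScalingLimit.Theorems.PickHalfPlane.Engine

/-! ### The up-oriented interior pairs and the three conversions -/

/-- The up-oriented adjacent pairs with both endpoints in `S`, as a finset of ordered pairs. -/
theorem mem_upPairs_iff (S : Finset HexVertex) (p : HexVertex × HexVertex) :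
    p ∈ ((S.filter fun v => v.2 = 0) ×ˢ S).filter (fun p => p.2 ∈ nbrs p.1) ↔
      p.1 ∈ S.filter (fun v => v.2 = 0) ∧ p.2 ∈ (nbrs p.1).filter (· ∈ S) := by
  simp only [Finset.mem_filter, Finset.mem_product]
  tauto

/-- The map `p ↦ {p.1, p.2}` is injective on up-oriented pairs (an edge has one up endpoint).
[folklore] -/
theorem injOn_mk_upPairs (S : Finset HexVertex) :
    Set.InjOn (fun p : HexVertex × HexVertex => s(p.1, p.2))
      ↑(((S.filter fun v => v.2 = 0) ×ˢ S).filter (fun p => p.2 ∈ nbrs p.1)) := by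
  intro p hp q hq hpq
  rw [Finset.mem_coe, mem_upPairs_iff] at hp hq
  rcases Sym2.eq_iff.1 hpq with ⟨h1, h2⟩ | ⟨h1, h2⟩
  · exact Prod.ext h1 h2
  · exfalso
    have hp0 : p.1.2 = 0 := (Finset.mem_filter.1 hp.1).2
    have hq0 : q.1.2 = 0 := (Finset.mem_filter.1 hq.1).2
    have hq2 : q.2.2 = 1 := snd_eq_one_of_mem_nbrs hq0 (Finset.mem_filter.1 hq.2).1
    rw [← h1, hp0] at hq2
    exact absurd hq2 (by decide)

/-- **Conversion 1 (pairs).** A function of ordered pairs vanishing on the up-oriented pairs of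
`Ω_S` with an endpoint off `S` sums, over the index set of the route's conjugate-class sum
`{p | {p.1,p.2} ∈ Ω_S, p.1 up}`, to its double sum over up faces of `S` and their neighbours in
`S`. [folklore] -/
theorem finsum_pairs_eq_sum_up (S : Finset HexVertex) (f : HexVertex × HexVertex → ℂ)
    (hf : ∀ p : HexVertex × HexVertex, p.1.2 = 0 → p.2 ∈ nbrs p.1 → (p.1 ∈ S ∨ p.2 ∈ S) →
      ¬ (p.1 ∈ S ∧ p.2 ∈ S) → f p = 0) :
    (∑ᶠ p ∈ {p : HexVertex × HexVertex | s(p.1, p.2) ∈ hexDomainMidEdges S ∧ p.1.2 = 0}, f p) =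
      ∑ v ∈ S.filter (fun v => v.2 = 0), ∑ w ∈ (nbrs v).filter (· ∈ S), f (v, w) := by
  classical
  rw [← Finset.sum_finset_product' _ _ _ (mem_upPairs_iff S)]
  refine finsum_mem_eq_sum_of_inter_support_eq f ?_
  ext p
  rw [Set.mem_inter_iff, Set.mem_inter_iff, Set.mem_setOf_eq, Finset.mem_coe, mem_upPairs_iff,
    Function.mem_support]
  constructor
  · rintro ⟨⟨hpE, hp0⟩, hfp⟩
    have hadj : hexGraph.Adj p.1 p.2 := (SimpleGraph.mem_edgeSet hexGraph).1 hpE.1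
    have hnb : p.2 ∈ nbrs p.1 := (mem_nbrs_iff _ _).2 hadj
    have hone : p.1 ∈ S ∨ p.2 ∈ S := by
      obtain ⟨-, x, hx, hxS⟩ := hpE
      rcases Sym2.mem_iff.1 hx with rfl | rfl
      · exact Or.inl hxS
      · exact Or.inr hxS
    have hboth : p.1 ∈ S ∧ p.2 ∈ S := by
      by_contra h; exact hfp (hf p hp0 hnb hone h)
    exact ⟨⟨Finset.mem_filter.2 ⟨hboth.1, hp0⟩, Finset.mem_filter.2 ⟨hnb, hboth.2⟩⟩, hfp⟩
  · rintro ⟨⟨hp1, hp2⟩, hfp⟩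
    obtain ⟨hp1S, hp0⟩ := Finset.mem_filter.1 hp1
    obtain ⟨hnb, -⟩ := Finset.mem_filter.1 hp2
    exact ⟨⟨⟨(SimpleGraph.mem_edgeSet hexGraph).2 ((mem_nbrs_iff _ _).1 hnb), p.1,
      Sym2.mem_mk_left _ _, hp1S⟩, hp0⟩, hfp⟩

/-- **Conversion 2 (mid-edges).** A function of mid-edges vanishing on the boundary mid-edges of
`S` sums, over `Ω_S`, to its double sum over up faces of `S` and their neighbours in `S` (every
interior edge has exactly one up endpoint). [folklore] -/
theorem finsum_midEdges_eq_sum_up (S : Finset HexVertex) (g : Sym2 HexVertex → ℂ)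
    (hg : ∀ v w : HexVertex, hexGraph.Adj v w → v ∈ S → w ∉ S → g s(v, w) = 0) :
    (∑ᶠ z ∈ hexDomainMidEdges S, g z) =
      ∑ v ∈ S.filter (fun v => v.2 = 0), ∑ w ∈ (nbrs v).filter (· ∈ S), g s(v, w) := by
  classical
  set r := ((S.filter fun v => v.2 = 0) ×ˢ S).filter (fun p => p.2 ∈ nbrs p.1) with hr
  have hE := hexDomainMidEdges_finite S
  rw [← Finset.sum_finset_product' r _ _ (mem_upPairs_iff S) (f := fun v w => g s(v, w)),
    ← Finset.sum_image (injOn_mk_upPairs S), finsum_mem_eq_finite_toFinset_sum g hE]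
  symm
  refine Finset.sum_subset ?_ ?_
  · intro e he
    obtain ⟨p, hp, rfl⟩ := Finset.mem_image.1 he
    rw [mem_upPairs_iff] at hp
    refine hE.mem_toFinset.2 ⟨(SimpleGraph.mem_edgeSet hexGraph).2
      ((mem_nbrs_iff _ _).1 (Finset.mem_filter.1 hp.2).1), p.1, Sym2.mem_mk_left _ _,
      (Finset.mem_filter.1 hp.1).1⟩
  · intro e he hne
    obtain ⟨heE, x, hx, hxS⟩ := hE.mem_toFinset.1 he
    -- write `e = {x, y}` with `x ∈ S`
    induction e using Sym2.ind with
    | h x₁ y₁ =>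
      have hadj : hexGraph.Adj x₁ y₁ := (SimpleGraph.mem_edgeSet hexGraph).1 heE
      -- if both endpoints were in `S`, the edge would be the image of an up-oriented pair
      have hnot : ¬ (x₁ ∈ S ∧ y₁ ∈ S) := by
        rintro ⟨hxS', hyS'⟩
        apply hne
        rcases snd_eq_zero_or_one x₁ with h0 | h1
        · exact Finset.mem_image.2 ⟨(x₁, y₁), (mem_upPairs_iff S _).2
            ⟨Finset.mem_filter.2 ⟨hxS', h0⟩, Finset.mem_filter.2
              ⟨(mem_nbrs_iff _ _).2 hadj, hyS'⟩⟩, rfl⟩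
        · have hy0 : y₁.2 = 0 := by
            have := snd_eq_zero_of_mem_nbrs h1 ((mem_nbrs_iff _ _).2 hadj); exact this
          exact Finset.mem_image.2 ⟨(y₁, x₁), (mem_upPairs_iff S _).2
            ⟨Finset.mem_filter.2 ⟨hyS', hy0⟩, Finset.mem_filter.2
              ⟨(mem_nbrs_iff _ _).2 hadj.symm, hxS'⟩⟩, Sym2.eq_swap⟩
      rcases Sym2.mem_iff.1 hx with rfl | rfl
      · exact hg x y₁ hadj hxS fun hy => hnot ⟨hxS, hy⟩
      · rw [Sym2.eq_swap]
        exact hg x x₁ hadj.symm hxS fun hx' => hnot ⟨hx', hxS⟩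

/-- **Conversion 3 (masses).** The sum of `‖F‖` over the up-oriented interior pairs whose scaled
midpoint lies in a set `T` is at most the `finsum` of `‖F‖` over the mid-edges of `Ω_S` with
scaled midpoint in `T`. [folklore] -/
theorem sum_up_norm_le_finsum (S : Finset HexVertex) (F : Sym2 HexVertex → ℂ) (δ : ℝ)
    (T : Set ℂ) [DecidablePred (· ∈ T)] :
    ∑ v ∈ S.filter (fun v => v.2 = 0), ∑ w ∈ (nbrs v).filter (· ∈ S),
        (if (δ : ℂ) * hexMidpoint s(v, w) ∈ T then ‖F s(v, w)‖ else 0) ≤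
      ∑ᶠ z ∈ {z : Sym2 HexVertex | z ∈ hexDomainMidEdges S ∧ (δ : ℂ) * hexMidpoint z ∈ T},
        ‖F z‖ := by
  classical
  set r := ((S.filter fun v => v.2 = 0) ×ˢ S).filter (fun p => p.2 ∈ nbrs p.1) with hr
  set E : Set (Sym2 HexVertex) :=
    {z | z ∈ hexDomainMidEdges S ∧ (δ : ℂ) * hexMidpoint z ∈ T} with hEdef
  have hEfin : E.Finite := (hexDomainMidEdges_finite S).subset fun e he => he.1
  set g : Sym2 HexVertex → ℝ := fun z => if (δ : ℂ) * hexMidpoint z ∈ T then ‖F z‖ else 0 with hgd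
  have hg0 : ∀ z, 0 ≤ g z := fun z => by simp only [hgd]; split_ifs <;> positivity
  calc ∑ v ∈ S.filter (fun v => v.2 = 0), ∑ w ∈ (nbrs v).filter (· ∈ S), g s(v, w)
      = ∑ p ∈ r, g s(p.1, p.2) :=
        (Finset.sum_finset_product' r _ _ (mem_upPairs_iff S) (f := fun v w => g s(v, w))).symm
    _ = ∑ e ∈ r.image (fun p : HexVertex × HexVertex => s(p.1, p.2)), g e :=
        (Finset.sum_image (injOn_mk_upPairs S)).symm
    _ ≤ ∑ e ∈ (hexDomainMidEdges_finite S).toFinset, g e := by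
        refine Finset.sum_le_sum_of_subset_of_nonneg ?_ fun _ _ _ => hg0 _
        intro e he
        obtain ⟨p, hp, rfl⟩ := Finset.mem_image.1 he
        rw [mem_upPairs_iff] at hp
        exact (Set.Finite.mem_toFinset _).2 ⟨(SimpleGraph.mem_edgeSet hexGraph).2
          ((mem_nbrs_iff _ _).1 (Finset.mem_filter.1 hp.2).1), p.1, Sym2.mem_mk_left _ _,
          (Finset.mem_filter.1 hp.1).1⟩
    _ = ∑ᶠ z ∈ hexDomainMidEdges S, g z := (finsum_mem_eq_finite_toFinset_sum g _).symm
    _ = ∑ᶠ z ∈ E, ‖F z‖ := by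
        rw [finsum_mem_eq_finite_toFinset_sum g (hexDomainMidEdges_finite S),
          finsum_mem_eq_finite_toFinset_sum _ hEfin, ← Finset.sum_filter_add_sum_filter_not
            (hexDomainMidEdges_finite S).toFinset (fun z => (δ : ℂ) * hexMidpoint z ∈ T)]
        have h1 : ∑ z ∈ (hexDomainMidEdges_finite S).toFinset.filter
            (fun z => ¬ (δ : ℂ) * hexMidpoint z ∈ T), g z = 0 :=
          Finset.sum_eq_zero fun z hz => by
            simp only [hgd, if_neg (Finset.mem_filter.1 hz).2]
        rw [h1, add_zero]
        have h2 : (hexDomainMidEdges_finite S).toFinset.filter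
            (fun z => (δ : ℂ) * hexMidpoint z ∈ T) = hEfin.toFinset := by
          ext z
          simp only [Finset.mem_filter, Set.Finite.mem_toFinset, hEdef, Set.mem_setOf_eq]
        rw [h2]
        refine Finset.sum_congr rfl fun z hz => ?_
        simp only [hgd, if_pos ((hEfin.mem_toFinset.1 hz).2)]

/-! ### The summed identity and its bound -/

/-- **The summed lattice identity, bounded (registered sub-goal `pickEngine_weakDbarBound` of
stub `stub_pickEngine`).** Let `F` satisfy the vertex relations on the finite vertex set `S`, let
`φ` be supported in `K`, `0 < δ ≤ ε₀`, suppose every face with scaled centre in the closed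
`ε₀`-thickening of `K` belongs to `S`, and suppose the per-edge Taylor bound with constant `C`
(`pickEngine_edgeTaylor`). Then
`‖(1/3)·δ²(Σᶠ_{Ω_S} ∂̄φ(δ·mid) F)/F(b) + 3a³·δ²(Σᶠ_{up pairs} ∂φ(δ·mid) conj(c₂-c₁) F)/F(b)‖
 ≤ 2C·δ·(δ² Σᶠ_{Ω_S, δ·mid ∈ K_{ε₀}} ‖F‖)/‖F(b)‖` — `(1/3)N_δ(∂̄φ) + 3a³·(conjugate-class
sum at ∂φ)` is `O(δ · local mass)`. [folklore] -/
theorem pickEngine_weakDbarBound :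
    ∀ (S : Finset HexVertex) (F : Sym2 HexVertex → ℂ) (bb : Sym2 HexVertex) (φ : ℂ → ℂ)
      (K : Set ℂ) (C δ ε₀ : ℝ), SatisfiesVertexRelations S F → tsupport φ ⊆ K → 0 ≤ C → 0 < δ →
      δ ≤ ε₀ → (∀ v : HexVertex, (δ : ℂ) * hexCenter v ∈ Metric.cthickening ε₀ K → v ∈ S) →
      (∀ (v w : HexVertex), v.2 = 0 → w ∈ nbrs v →
        ‖(φ ((δ : ℂ) * hexCenter v) - φ ((δ : ℂ) * hexCenter w)) * term F v w +
            (δ : ℂ) / 2 * F s(v, w) *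
              (3 * vecA ^ 3 * conj (hexCenter w - hexCenter v) *
                  ((2 : ℂ)⁻¹ * (fderiv ℝ φ ((δ : ℂ) * hexMidpoint s(v, w)) 1 -
                    I * fderiv ℝ φ ((δ : ℂ) * hexMidpoint s(v, w)) I)) +
                (1 / 3 : ℂ) * dbarAlong 1 φ ((δ : ℂ) * hexMidpoint s(v, w)))‖ ≤
          C * δ ^ 2 * ‖F s(v, w)‖) →
      ‖(1 / 3 : ℂ) * ((δ : ℂ) ^ 2 * (∑ᶠ z ∈ hexDomainMidEdges S,
            dbarAlong 1 φ ((δ : ℂ) * hexMidpoint z) * F z) / F bb) +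
          3 * vecA ^ 3 * ((δ : ℂ) ^ 2 * (∑ᶠ p ∈ {p : HexVertex × HexVertex |
              s(p.1, p.2) ∈ hexDomainMidEdges S ∧ p.1.2 = 0},
            (2 : ℂ)⁻¹ * (fderiv ℝ φ ((δ : ℂ) * hexMidpoint s(p.1, p.2)) 1 -
                I * fderiv ℝ φ ((δ : ℂ) * hexMidpoint s(p.1, p.2)) I) *
              conj (hexCenter p.2 - hexCenter p.1) * F s(p.1, p.2)) / F bb)‖ ≤
        2 * C * δ * (δ ^ 2 * (∑ᶠ z ∈ {z : Sym2 HexVertex | z ∈ hexDomainMidEdges S ∧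
            (δ : ℂ) * hexMidpoint z ∈ Metric.cthickening ε₀ K}, ‖F z‖) / ‖F bb‖) := by
  intro S F bb φ K C δ ε₀ hVR hK hC hδ hδε hexh hedge
  classical
  -- the three evaluated test functions
  set Φ : HexVertex → ℂ := fun v => φ ((δ : ℂ) * hexCenter v) with hΦ
  set ψ₁ : ℂ → ℂ := dbarAlong 1 φ with hψ₁
  set ψ₂ : ℂ → ℂ := fun z => (2 : ℂ)⁻¹ * (fderiv ℝ φ z 1 - I * fderiv ℝ φ z I) with hψ₂
  have hφK : ∀ z, z ∉ K → φ z = 0 := fun z hz =>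
    image_eq_zero_of_notMem_tsupport fun h => hz (hK h)
  have hψ₁K : ∀ z, z ∉ K → ψ₁ z = 0 := fun z hz =>
    dbarAlong_eq_zero_of_notMem_tsupport fun h => hz (hK h)
  have hψ₂K : ∀ z, z ∉ K → ψ₂ z = 0 := by
    intro z hz
    have hfd : fderiv ℝ φ z = 0 := by
      by_contra hne
      exact hz (hK (support_fderiv_subset ℝ (Function.mem_support.2 hne)))
    simp [hψ₂, hfd]
  ---------------------------------------------------------------- margins at scale `δ`
  have hmid : ∀ v w : HexVertex, hexGraph.Adj v w →
      dist ((δ : ℂ) * hexMidpoint s(v, w)) ((δ : ℂ) * hexCenter v) ≤ ε₀ := by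
    intro v w h
    rw [dist_smul_smul hδ.le, dist_eq_norm]
    calc δ * ‖hexMidpoint s(v, w) - hexCenter v‖ ≤ δ * (1 / 2) :=
          mul_le_mul_of_nonneg_left (norm_hexMidpoint_sub_hexCenter_le h) hδ.le
      _ ≤ ε₀ := by linarith
  have hmid' : ∀ v w : HexVertex, hexGraph.Adj v w →
      dist ((δ : ℂ) * hexMidpoint s(v, w)) ((δ : ℂ) * hexCenter w) ≤ ε₀ := by
    intro v w h
    rw [Sym2.eq_swap]
    exact hmid w v h.symm
  have hcen : ∀ v w : HexVertex, hexGraph.Adj v w →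
      dist ((δ : ℂ) * hexCenter w) ((δ : ℂ) * hexCenter v) ≤ ε₀ := by
    intro v w h
    rw [dist_smul_smul hδ.le, dist_comm]
    calc δ * dist (hexCenter v) (hexCenter w) ≤ δ * 1 := by
          refine mul_le_mul_of_nonneg_left ?_ hδ.le
          have := dist_hexCenter_le_one_of_adj h
          rwa [dist_comm] at this
      _ ≤ ε₀ := by linarith
  -- a mid-edge whose scaled midpoint lies in `K` is interior
  have hint_of_mid : ∀ v w : HexVertex, hexGraph.Adj v w →
      (δ : ℂ) * hexMidpoint s(v, w) ∈ K → v ∈ S ∧ w ∈ S := fun v w h hm =>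
    ⟨hexh v (mem_cthickening_of_dist_le _ _ _ _ hm (by rw [dist_comm]; exact hmid v w h)),
      hexh w (mem_cthickening_of_dist_le _ _ _ _ hm (by rw [dist_comm]; exact hmid' v w h))⟩
  ---------------------------------------------------------------- (a)+(b): the interior sum of `(Φ v - Φ w) term` vanishes
  have hbd : ∀ v ∈ S, ∀ w ∈ (nbrs v).filter (· ∉ S), Φ v * term F v w = 0 := by
    intro v hv w hw
    obtain ⟨hwn, hwS⟩ := Finset.mem_filter.1 hw
    have hadj : hexGraph.Adj v w := (mem_nbrs_iff _ _).1 hwn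
    have hΦ0 : Φ v = 0 := by
      by_contra hne
      apply hwS
      have hvK : (δ : ℂ) * hexCenter v ∈ K := by
        by_contra h; exact hne (hφK _ h)
      exact hexh w (mem_cthickening_of_dist_le _ _ _ _ hvK (hcen v w hadj))
    rw [hΦ0, zero_mul]
  have hint0 : ∑ v ∈ S.filter (fun v => v.2 = 0), ∑ w ∈ (nbrs v).filter (· ∈ S),
      (Φ v - Φ w) * term F v w = 0 := by
    rw [starRegrouping_of_satisfiesVertexRelations hVR Φ,
      Finset.sum_eq_zero fun v hv => Finset.sum_eq_zero (hbd v hv), neg_zero]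
  ---------------------------------------------------------------- (c): the per-edge terms, summed
  set E : HexVertex → HexVertex → ℂ := fun v w =>
    (Φ v - Φ w) * term F v w + (δ : ℂ) / 2 * F s(v, w) *
      (3 * vecA ^ 3 * conj (hexCenter w - hexCenter v) * ψ₂ ((δ : ℂ) * hexMidpoint s(v, w)) +
        (1 / 3 : ℂ) * ψ₁ ((δ : ℂ) * hexMidpoint s(v, w))) with hE
  set A : ℂ := ∑ v ∈ S.filter (fun v => v.2 = 0), ∑ w ∈ (nbrs v).filter (· ∈ S),
    ψ₁ ((δ : ℂ) * hexMidpoint s(v, w)) * F s(v, w) with hA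
  set B : ℂ := ∑ v ∈ S.filter (fun v => v.2 = 0), ∑ w ∈ (nbrs v).filter (· ∈ S),
    ψ₂ ((δ : ℂ) * hexMidpoint s(v, w)) * conj (hexCenter w - hexCenter v) * F s(v, w) with hB
  set Esum : ℂ := ∑ v ∈ S.filter (fun v => v.2 = 0), ∑ w ∈ (nbrs v).filter (· ∈ S), E v w
    with hEsum
  have hidentity : (δ : ℂ) / 2 * (3 * vecA ^ 3 * B + (1 / 3 : ℂ) * A) = Esum := by
    rw [hEsum, hA, hB]
    simp only [hE]
    rw [Finset.sum_congr rfl fun v _ => Finset.sum_add_distrib, Finset.sum_add_distrib, hint0,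
      zero_add, mul_add]
    simp only [Finset.mul_sum]
    rw [← Finset.sum_add_distrib]
    refine Finset.sum_congr rfl fun v _ => ?_
    rw [← Finset.sum_add_distrib]
    refine Finset.sum_congr rfl fun w _ => ?_
    ring
  ---------------------------------------------------------------- (d): conversions to the route's sums
  have hN : (∑ᶠ z ∈ hexDomainMidEdges S, dbarAlong 1 φ ((δ : ℂ) * hexMidpoint z) * F z) = A := by
    refine finsum_midEdges_eq_sum_up S _ fun v w hadj hv hw => ?_
    have hmK : (δ : ℂ) * hexMidpoint s(v, w) ∉ K := fun h => hw (hint_of_mid v w hadj h).2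
    show ψ₁ ((δ : ℂ) * hexMidpoint s(v, w)) * F s(v, w) = 0
    rw [hψ₁K _ hmK, zero_mul]
  have hCC : (∑ᶠ p ∈ {p : HexVertex × HexVertex | s(p.1, p.2) ∈ hexDomainMidEdges S ∧ p.1.2 = 0},
      (2 : ℂ)⁻¹ * (fderiv ℝ φ ((δ : ℂ) * hexMidpoint s(p.1, p.2)) 1 -
          I * fderiv ℝ φ ((δ : ℂ) * hexMidpoint s(p.1, p.2)) I) *
        conj (hexCenter p.2 - hexCenter p.1) * F s(p.1, p.2)) = B := by
    refine finsum_pairs_eq_sum_up S _ fun p hp0 hnb hone hnot => ?_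
    have hadj : hexGraph.Adj p.1 p.2 := (mem_nbrs_iff _ _).1 hnb
    have hmK : (δ : ℂ) * hexMidpoint s(p.1, p.2) ∉ K := fun h => hnot (hint_of_mid p.1 p.2 hadj h)
    show ψ₂ ((δ : ℂ) * hexMidpoint s(p.1, p.2)) * conj (hexCenter p.2 - hexCenter p.1) *
      F s(p.1, p.2) = 0
    rw [hψ₂K _ hmK, zero_mul, zero_mul]
  ---------------------------------------------------------------- (e): the bound on `Esum`
  set M : ℝ := ∑ v ∈ S.filter (fun v => v.2 = 0), ∑ w ∈ (nbrs v).filter (· ∈ S),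
    (if (δ : ℂ) * hexMidpoint s(v, w) ∈ Metric.cthickening ε₀ K then ‖F s(v, w)‖ else 0) with hM
  have hEle : ‖Esum‖ ≤ C * δ ^ 2 * M := by
    rw [hEsum, hM, Finset.mul_sum]
    refine (norm_sum_le _ _).trans (Finset.sum_le_sum fun v hv => ?_)
    rw [Finset.mul_sum]
    refine (norm_sum_le _ _).trans (Finset.sum_le_sum fun w hw => ?_)
    have hv0 : v.2 = 0 := (Finset.mem_filter.1 hv).2
    have hwn : w ∈ nbrs v := (Finset.mem_filter.1 hw).1
    have hadj : hexGraph.Adj v w := (mem_nbrs_iff _ _).1 hwn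
    by_cases hm : (δ : ℂ) * hexMidpoint s(v, w) ∈ Metric.cthickening ε₀ K
    · rw [if_pos hm]
      exact hedge v w hv0 hwn
    · -- far from `K`: everything vanishes
      rw [if_neg hm, mul_zero]
      have hmK : (δ : ℂ) * hexMidpoint s(v, w) ∉ K := fun h => hm (Metric.self_subset_cthickening _ h)
      have hvK : (δ : ℂ) * hexCenter v ∉ K := fun h =>
        hm (mem_cthickening_of_dist_le _ _ _ _ h (hmid v w hadj))
      have hwK : (δ : ℂ) * hexCenter w ∉ K := fun h =>
        hm (mem_cthickening_of_dist_le _ _ _ _ h (hmid' v w hadj))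
      have : E v w = 0 := by
        simp only [hE, hΦ, hφK _ hvK, hφK _ hwK, hψ₁K _ hmK, hψ₂K _ hmK]; ring
      rw [this, norm_zero]
  have hMle : M ≤ ∑ᶠ z ∈ {z : Sym2 HexVertex | z ∈ hexDomainMidEdges S ∧
      (δ : ℂ) * hexMidpoint z ∈ Metric.cthickening ε₀ K}, ‖F z‖ :=
    sum_up_norm_le_finsum S F δ (Metric.cthickening ε₀ K)
  ---------------------------------------------------------------- conclusion
  rw [hN, hCC]
  have hδ0 : (δ : ℂ) ≠ 0 := Complex.ofReal_ne_zero.2 hδ.ne'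
  have hX : (1 / 3 : ℂ) * A + 3 * vecA ^ 3 * B = 2 / (δ : ℂ) * Esum := by
    rw [← hidentity]; field_simp; ring
  have hQ : (1 / 3 : ℂ) * ((δ : ℂ) ^ 2 * A / F bb) + 3 * vecA ^ 3 * ((δ : ℂ) ^ 2 * B / F bb) =
      (δ : ℂ) ^ 2 / F bb * (2 / (δ : ℂ)) * Esum := by
    have : (1 / 3 : ℂ) * ((δ : ℂ) ^ 2 * A / F bb) + 3 * vecA ^ 3 * ((δ : ℂ) ^ 2 * B / F bb) =
        (δ : ℂ) ^ 2 / F bb * ((1 / 3 : ℂ) * A + 3 * vecA ^ 3 * B) := by ring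
    rw [this, hX]; ring
  rw [hQ, norm_mul, norm_mul, norm_div, norm_div, norm_pow, Complex.norm_real, Complex.norm_two,
    Real.norm_eq_abs, abs_of_pos hδ]
  have hfac : 0 ≤ δ ^ 2 / ‖F bb‖ * (2 / δ) := by positivity
  calc δ ^ 2 / ‖F bb‖ * (2 / δ) * ‖Esum‖ ≤ δ ^ 2 / ‖F bb‖ * (2 / δ) * (C * δ ^ 2 * M) :=
        mul_le_mul_of_nonneg_left hEle hfac
    _ ≤ δ ^ 2 / ‖F bb‖ * (2 / δ) * (C * δ ^ 2 * ∑ᶠ z ∈ {z : Sym2 HexVertex |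
          z ∈ hexDomainMidEdges S ∧ (δ : ℂ) * hexMidpoint z ∈ Metric.cthickening ε₀ K}, ‖F z‖) := by
        gcongr
    _ = 2 * C * δ * (δ ^ 2 * (∑ᶠ z ∈ {z : Sym2 HexVertex | z ∈ hexDomainMidEdges S ∧
          (δ : ℂ) * hexMidpoint z ∈ Metric.cthickening ε₀ K}, ‖F z‖) / ‖F bb‖) := by
        field_simp

end Summit.CriticalPhenomena.SAWScalingLimit.Theorems.PickHalfPlane.Engine

end
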